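import Literature.AlgebraicGeometry.Frobenioids.CosetBaseEquivalenceObjects
import Literature.IUT.HodgeTheaters.InitialThetaDataLocalSlim
import Literature.IUT.HodgeTheaters.InitialThetaDataLocalGaloisProofs
import Literature.IUT.HodgeTheaters.ReconstructibleAlongCriterion
import Literature.IUT.HodgeTheaters.CountableAbsoluteGaloisGroup
import Literature.IUT.HodgeTheaters.CoveringsErrata
import Literature.IUT.HodgeTheaters.CoveringsErrataProofsE2
import HarnessLib

/-!
# [IUTchI] Example 3.3 (iii) (a) AT THE PRINTED OBJECT: `D⊢_v̲ ⊆ D_v̲` from `D_v̲ = 𝓑(Π_{X̲→_v̲})⁰`, conditional on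
# [AbsAnab] Lemma 1.3.8 (FACT F-0007 `PreservesGeom`) by name

S. Mochizuki, *Inter-universal Teichmüller theory I*, kurims manuscript (May 2020), Example 3.3 (iii) p. 79:
"(a) the subcategory `D⊢_v ⊆ D_v` may be reconstructed category-theoretically from `D_v` [cf. [AbsAnab], Lemma
1.3.8]" [claim: Mochizuki2012, status: disputed] (D-0012 claim key, series status DISPUTED — this file is a PROOF-ONLY
composition of landed theorems; nothing of the series is asserted and no side is taken on [IUTchIII] Cor. 3.12).
DAG node `IUTchI:Ex3.3(iii)`, row E33iii/a of `plan/L5/SUBDAG-IUTchI-Ex33-Ex34.md` (status before this file: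
"MERGE SOCKET in tree … RESIDUAL = essential-image invariance for the REAL base").
S. Mochizuki, *The absolute anabelian geometry of hyperbolic curves* (2004), Lemma 1.3.8 p. 18: an isomorphism
`Π_{(X₁)_{K₁}} ≅ Π_{(X₂)_{K₂}}` of arithmetic fundamental groups of hyperbolic curves over finite extensions of `ℚ_{pᵢ}`
"is compatible with the quotients `Π ↠ G_{Kᵢ}`" — abc-iut-L4's PREDICATE `FundamentalExtension.PreservesGeom α`
(`Δ.map α = Δ`), FACT-LIST F-0007, consumed BY NAME / in unfolded form [cite: MochizukiAbsAnab2004, Lemma 1.3.8 p.18].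
S. Mochizuki, *The geometry of Frobenioids II*, Kyushu J. Math. **62** (2008), Thm. 2.4 (ii) p. 21 (an equivalence
of base categories induces an isomorphism of groups "well-defined up to … elements of `G₂`")
[cite: MochizukiFrdII2008, Thm 2.4 (ii) p.21].

WHAT IS PROVED.
* `GoodLocalFrobenioid.ddashFromD_ofGalois_of_forall_map_ker` — over abc-iut-L5-t2's REAL bases
  `D_v = CosetCat Π_v ⊇ D⊢_v = CosetCat G_v` (`GoodLocalFrobenioid.ofGalois`, pull-back along `aug : Π_v ↠ G_v`),
  `Π_v` profinite (tempered) and Galois-countable: IF every bicontinuous automorphism of `Π_v` carries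
  `Δ_v = Ker(aug)` onto itself (the content of [AbsAnab] Lem. 1.3.8), THEN `DdashFromD` holds.  Mechanism: a
  self-equivalence `e` of `CosetCat Π_v` acts on objects through a bicontinuous `φ : Π_v ≃ₜ* Π_v` up to conjugacy
  (`BaseGaloisSystem.exists_continuousMulEquiv_forall_obj_conj_of_cosetCat_equivalence`, from abc-iut-L1's [FrdII]
  Thm. 2.4 (ii) reconstruction `exists_mulEquiv_compatible_of_cosetCat_equivalence`); `φ(Δ_v) = Δ_v ⊴ Π_v` ⇒ `e`
  preserves the objects `Π_v/H`, `H ⊇ Δ_v` = the essential image of `D⊢_v`; the socket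
  `GoodLocalFrobenioid.ddashFromD_of_essImage_invariant` (`ReconstructibleAlongCriterion.lean`) concludes.
* `InitialThetaData.ddashFromD_goodLocalFrobenioidOfEmb_of_forall_map_ker` / `_goodLocalFrobenioid_…` /
  `_goodLocalFrobenioidAt_…` — **(a) for the initial Θ-datum `D` ([IUTchI] Def. 3.1) at `v̲ ∈ V̲^good ∩ V̲^non`**,
  `Π_v̲ := Π_{X̲→_v̲} = Π_{X̲→_K} ×_{G_F} Gal(k̄/k)` (`InitialThetaDataGoodLocalFrobenioid.lean`), conditional on the same
  form of Lem. 1.3.8 for `Π_v̲`; `…_of_preservesGeom` consumes F-0007 `PreservesGeom` BY NAME for any packaging of the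
  local extension as a `FundamentalExtension`.  Remaining honest inputs: the datum's openness `hX` (Def. 3.1 (f), as in
  every file over `goodLocalFrobenioidOfEmb`) and Galois-countability of `Π_{C_F}` ([IUTchI] Rmk. 2.5.3 (ii) —
  `secondCountableTopology_PiC_of_tameGaloisCountable` derives it from FACT F-1979 `Rmk253.TameGaloisCountable
  D.geom.extF` BY NAME + (E1) for the countable field `F`); Galois-countability of `G_v̲ = Gal(k̄/k)` is PROVED when
  `K ⊆ k` is dense (`secondCountableTopology_galLoc`: closed embedding into `G_F` by abc-iut-L5-t2's Krasner-density
  injectivity `localToGF_injective`), in particular at every actual place `K_v̲ = K_w`.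
No new definition.  typed ≠ proved elsewhere; DISCHARGED here = proved as typed under OUR kernel, modulo the named
hypotheses displayed in each signature.
-/

namespace Literature.IUT.HodgeTheaters

open CategoryTheory Literature.AnabelianGeometry.SemiGraphs Literature.AlgebraicGeometry.Frobenioids
open Literature.AlgebraicGeometry.Frobenioids.PadicFrd Literature.AnabelianGeometry.AbsoluteAnabelian Topology

universe u v

/-! ### (a) over the REAL bases `𝓑(Π_v)⁰ ⊇ 𝓑(G_v)⁰`, given that `Δ = Ker(Π_v ↠ G_v)` is characteristic -/

namespace GoodLocalFrobenioid

section OfGalois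

variable {p : ℕ} [Fact p.Prime] (d : GaloisValDatum.{u} p) {P : Type u} [Group P] [TopologicalSpace P]
  (aug : P →* d.Gal) (hc : Continuous aug) (hs : Function.Surjective aug) (ho : IsOpenMap aug)
  (Kv : Type) [Field Kv] [ValuativeRel Kv] (hp : ((p : Kv)) ∈ PadicFrd.intNonzero Kv)

/-- **[IUTchI] Ex. 3.3 (iii) (a) over the REAL bases** `D_v = 𝓑(Π_v)⁰ ⊇ D⊢_v = 𝓑(G_v)⁰` (`GoodLocalFrobenioid.ofGalois`,
small coset models, `D⊢_v ⊆ D_v` the pull-back along `aug : Π_v ↠ G_v`), for `Π_v` profinite-tempered and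
Galois-countable, CONDITIONAL on exactly the printed input [AbsAnab] Lem. 1.3.8 in the form "`Δ_v := Ker(Π_v ↠ G_v)`
is carried onto itself by every bicontinuous automorphism of `Π_v`" (`hΔ`; = `FundamentalExtension.PreservesGeom`,
FACT F-0007, for the extension `1 → Δ_v → Π_v → G_v → 1`): `D⊢_v ⊆ D_v` is reconstructible from `D_v`.  Proof: a
self-equivalence `e` of `CosetCat Π_v` acts on objects through a bicontinuous `φ : Π_v ≃ₜ* Π_v` up to conjugacy
(`BaseGaloisSystem.exists_continuousMulEquiv_forall_obj_conj_of_cosetCat_equivalence`); `φ(Δ_v) = Δ_v` and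
`Δ_v ⊴ Π_v` give that `e` preserves the objects `Π_v/H`, `H ⊇ Δ_v` = the essential image of `D⊢_v`; conclude by the
socket `ddashFromD_of_essImage_invariant`. ([IUTchI] Ex 3.3 (iii) (a) p.79) [claim: Mochizuki2012, status: disputed] -/
theorem ddashFromD_ofGalois_of_forall_map_ker [IsTopologicalGroup P] [SecondCountableTopology P]
    (hP : IsTempered P)
    (hΔ : ∀ φ : P ≃ₜ* P, aug.ker.map φ.toMulEquiv.toMonoidHom = aug.ker) :
    (ofGalois d aug hc hs ho Kv hp).DdashFromD := by
  apply ddashFromD_of_essImage_invariant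
  intro e A
  change (CosetCat.pull aug hc hs).essImage (e.functor.obj ((CosetCat.pull aug hc hs).obj A))
  obtain ⟨φ, hφ⟩ :=
    BaseGaloisSystem.exists_continuousMulEquiv_forall_obj_conj_of_cosetCat_equivalence hP hP
      (E := (e : CosetCat P ≌ CosetCat P))
  obtain ⟨c, hc'⟩ := hφ ((CosetCat.pull aug hc hs).obj A)
  -- `Δ_v ⊆ H'` for `e(Π_v/aug⁻¹V) = Π_v/H'`
  have hker : aug.ker ≤ ((e.functor.obj ((CosetCat.pull aug hc hs).obj A)).sg : Subgroup P) := by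
    intro x hx
    have hy : c * x * c⁻¹ ∈ aug.ker := aug.normal_ker.conj_mem x hx c
    rw [← hΔ φ, Subgroup.mem_map] at hy
    obtain ⟨g, hg, hgx⟩ := hy
    have hgA : g ∈ ((CosetCat.pull aug hc hs).obj A).sg := by
      change g ∈ A.sg.comap aug hc
      rw [OpenSubgroup.mem_comap, MonoidHom.mem_ker.mp hg]
      exact A.sg.one_mem
    have h := (hc' g).1 hgA
    have hgx' : φ g = c * x * c⁻¹ := hgx
    rwa [hgx', show c⁻¹ * (c * x * c⁻¹) * c = x by group] at h
  refine ⟨⟨CosetCat.mapOpen aug ho (e.functor.obj ((CosetCat.pull aug hc hs).obj A)).sg⟩, ⟨eqToIso ?_⟩⟩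
  apply CosetCat.ext
  apply OpenSubgroup.toSubgroup_injective
  change ((e.functor.obj ((CosetCat.pull aug hc hs).obj A)).sg.toSubgroup.map aug).comap aug =
    (e.functor.obj ((CosetCat.pull aug hc hs).obj A)).sg.toSubgroup
  exact Subgroup.comap_map_eq_self hker

end OfGalois

end GoodLocalFrobenioid

/-! ### (a) for the initial Θ-datum at `v̲ ∈ V̲^good ∩ V̲^non`, `K_v̲ = k` -/

noncomputable section Datum

variable {F : Type u} {K : Type v} {Fbar : Type} [Field F] [NumberField F] [Field K] [NumberField K]
  [Algebra F K] [Field Fbar] [Algebra F Fbar] [Algebra K Fbar] [IsScalarTower F K Fbar] [Normal K Fbar]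
  {E : WeierstrassCurve F} [E.IsElliptic] {l : ℕ} {Pb : BadPlacePredicates K}
  (D : InitialThetaData F K Fbar E l Pb) (p : ℕ) [Fact p.Prime]
  (k : Type) [NontriviallyNormedField k] [CompleteSpace k] [IsUltrametricDist k] [NormedAlgebra ℚ_[p] k]
  [FiniteDimensional ℚ_[p] k] [Algebra K k]

namespace InitialThetaData

omit [IsScalarTower F K Fbar] [Normal K Fbar] in
include D in
/-- `F̄` is countable (an algebraic closure of the number field `F`). [claim: Mochizuki2012, status: disputed] -/
theorem countable_Fbar : Countable Fbar := by
  haveI := D.isAlgClosure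
  haveI : Algebra.IsAlgebraic F Fbar := IsAlgClosure.isAlgebraic
  haveI : Countable F := by
    let b := Module.finBasis ℚ F
    exact Function.Injective.countable (f := b.equivFun) b.equivFun.injective
  have h := Algebra.IsAlgebraic.lift_cardinalMk_le_max F Fbar
  have hF : Cardinal.lift.{0} (Cardinal.mk F) ≤ Cardinal.aleph0 := by
    rw [Cardinal.lift_le_aleph0]; exact Cardinal.mk_le_aleph0
  have h2 : Cardinal.lift.{u} (Cardinal.mk Fbar) ≤ Cardinal.aleph0 := h.trans (max_le hF le_rfl)
  rw [Cardinal.lift_le_aleph0, Cardinal.mk_le_aleph0_iff] at h2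
  exact h2

omit [IsScalarTower F K Fbar] [Normal K Fbar] in
include D in
/-- `G_F = Gal(F̄/F)` is Galois-countable ([IUTchI] Rmk. 2.5.3 (ii) (E1): `F̄` is countable; abc-iut-L5-t6's
`Rmk253.secondCountableTopology_algEquiv`). [claim: Mochizuki2012, status: disputed] -/
theorem secondCountableTopology_galF : SecondCountableTopology (Fbar ≃ₐ[F] Fbar) := by
  haveI := D.isAlgClosure
  haveI : Algebra.IsAlgebraic F Fbar := IsAlgClosure.isAlgebraic
  haveI := D.countable_Fbar
  exact Rmk253.secondCountableTopology_algEquiv F Fbar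

omit [IsScalarTower F K Fbar] [Normal K Fbar] in
include D in
/-- **`Π_{C_F}` is Galois-countable as soon as (E2) holds for the datum's extension `Π_{C_F} ↠ G_F`** ([IUTchI] Rmk.
2.5.3 (ii): the frozen fact `Rmk253.TameGaloisCountable D.geom.extF` (F-1979) BY NAME, composed with (E1) for the
countable field `F` and the bicontinuous `D.geom.galIso : G ≅ G_F`). [claim: Mochizuki2012, status: disputed] -/
theorem secondCountableTopology_PiC_of_tameGaloisCountable (h : Rmk253.TameGaloisCountable D.geom.extF) :
    SecondCountableTopology D.PiC := by
  haveI := D.secondCountableTopology_galF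
  have e : D.geom.extF.gal ≃ₜ (Fbar ≃ₐ[F] Fbar) :=
    { D.geom.galIso.toEquiv with
      continuous_toFun := D.geom.galIso_continuous.1
      continuous_invFun := D.geom.galIso_continuous.2 }
  haveI : SecondCountableTopology D.geom.extF.gal := e.secondCountableTopology
  exact h inferInstance

omit [FiniteDimensional ℚ_[p] k] in
include D p in
/-- **`G_v̲ = Gal(k̄/k)` is Galois-countable** when `K` is dense in `k = K_v̲` ([IUTchI] Rmk. 2.5.3 (ii) (E1), the
"topological subquotients" clause: `Gal(k̄/k) ↪ G_F` continuously and injectively — abc-iut-L5-t2's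
`localToGF_injective` by Krasner density — a closed embedding of a compact group into the Galois-countable `G_F`).
[claim: Mochizuki2012, status: disputed] -/
theorem secondCountableTopology_galLoc (ι : Fbar →ₐ[K] AlgebraicClosure k) (hd : DenseRange (algebraMap K k)) :
    SecondCountableTopology (AlgebraicClosure k ≃ₐ[k] AlgebraicClosure k) := by
  haveI := D.isAlgClosure
  haveI : Algebra.IsAlgebraic F Fbar := IsAlgClosure.isAlgebraic
  haveI : IsAlgClosed Fbar := IsAlgClosure.isAlgClosed F
  haveI : T2Space (Fbar ≃ₐ[F] Fbar) := krullTopology_t2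
  haveI := D.secondCountableTopology_galF
  haveI := GaloisValDatum.charZero p k
  exact ((continuous_localToGF F k ι).isClosedEmbedding
    (localToGF_injective k ι F hd)).isEmbedding.secondCountableTopology

/-- **[IUTchI] Example 3.3 (iii) (a) for the initial Θ-datum `D` at `v̲ ∈ V̲^good ∩ V̲^non`, `K_v̲ = k` (with `K`
dense in `k`), along `ι : F̄ → k̄`** — at abc-iut-L5-t2's object `goodLocalFrobenioidOfEmb` (`D_v̲ = 𝓑(Π_v̲)⁰`,
`Π_v̲ := Π_{X̲→_v̲} = Π_{X̲→_K} ×_{G_F} Gal(k̄/k)`, `D⊢_v̲ = 𝓑(K_v̲)⁰` pulled back along `Π_v̲ ↠ Gal(k̄/k)`):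
**`D⊢_v̲ ⊆ D_v̲` is reconstructible from `D_v̲`, CONDITIONAL on the printed input [AbsAnab] Lem. 1.3.8** in the form
`hΔ`: every bicontinuous automorphism of `Π_v̲` carries `Δ_v̲ = Ker(Π_v̲ ↠ Gal(k̄/k))` onto itself (= FACT F-0007
`FundamentalExtension.PreservesGeom` for the local extension of `X̲→_v̲`; by-name form:
`ddashFromD_goodLocalFrobenioidOfEmb_of_preservesGeom`).  Other inputs: the datum's openness `hX` (Def. 3.1 (f)) and
the Galois-countability of `Π_{C_F}` ([IUTchI] Rmk. 2.5.3 (ii); `secondCountableTopology_PiC_of_tameGaloisCountable`).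
([IUTchI] Ex 3.3 (iii) (a) p.79) [claim: Mochizuki2012, status: disputed] -/
theorem ddashFromD_goodLocalFrobenioidOfEmb_of_forall_map_ker [SecondCountableTopology D.PiC]
    (ι : Fbar →ₐ[K] AlgebraicClosure k) (hX : IsOpen (D.PiXarrow : Set D.PiC)) (hd : DenseRange (algebraMap K k))
    (hΔ : ∀ φ : D.PiLoc D.PiXarrow (localToGF F k ι) ≃ₜ* D.PiLoc D.PiXarrow (localToGF F k ι),
      (D.augLoc D.PiXarrow (localToGF F k ι)).ker.map φ.toMulEquiv.toMonoidHom =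
        (D.augLoc D.PiXarrow (localToGF F k ι)).ker) :
    @GoodLocalFrobenioid.DdashFromD p k _ (GaloisValDatum.normVal k) (D.goodLocalFrobenioidOfEmb p k ι hX) := by
  letI := GaloisValDatum.normVal k
  haveI := GaloisValDatum.charZero p k
  haveI : CompactSpace (D.PiLoc D.PiXarrow (localToGF F k ι)) :=
    D.compactSpace_PiLoc D.PiXarrow (localToGF F k ι) hX (continuous_localToGF F k ι)
  haveI := D.secondCountableTopology_galLoc p k ι hd
  haveI : SecondCountableTopology (D.PiLoc D.PiXarrow (localToGF F k ι)) :=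
    (inferInstance : SecondCountableTopology
      ((D.PiLoc D.PiXarrow (localToGF F k ι) : Set (D.PiC × (AlgebraicClosure k ≃ₐ[k] AlgebraicClosure k)))))
  exact GoodLocalFrobenioid.ddashFromD_ofGalois_of_forall_map_ker (GaloisValDatum.ofComplete p k) _ _ _ _ k
    (GaloisValDatum.p_mem_normVal p k) IsTempered.of_profinite hΔ

/-- **[IUTchI] Ex. 3.3 (iii) (a) for `D` at `v̲`, `K_v̲ = k`, CONSUMING FACT F-0007 BY NAME**: for ANY packaging
`Ev` of the local extension `Π_v̲ ↠ Gal(k̄/k)` as an abc-iut-L4 `FundamentalExtension` (an identification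
`e : Ev.arith ≅ Π_v̲` carrying `Ev.geom = Δ` onto `Ker(Π_v̲ ↠ Gal(k̄/k))`), if every bicontinuous automorphism `α` of
`Ev.arith` satisfies `FundamentalExtension.PreservesGeom α` ([AbsAnab] Lem. 1.3.8 for the hyperbolic curve `X̲→_v̲`
over the MLF `K_v̲`), then `D⊢_v̲ ⊆ D_v̲` is reconstructible from `D_v̲` at `goodLocalFrobenioidOfEmb`.
([IUTchI] Ex 3.3 (iii) (a) p.79) [claim: Mochizuki2012, status: disputed] -/
theorem ddashFromD_goodLocalFrobenioidOfEmb_of_preservesGeom [SecondCountableTopology D.PiC]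
    (ι : Fbar →ₐ[K] AlgebraicClosure k) (hX : IsOpen (D.PiXarrow : Set D.PiC)) (hd : DenseRange (algebraMap K k))
    (Ev : FundamentalExtension.{0}) (e : Ev.arith ≃ₜ* D.PiLoc D.PiXarrow (localToGF F k ι))
    (he : Ev.geom.map e.toMulEquiv.toMonoidHom = (D.augLoc D.PiXarrow (localToGF F k ι)).ker)
    (hgeom : ∀ α : Ev.arith ≃ₜ* Ev.arith, FundamentalExtension.PreservesGeom α) :
    @GoodLocalFrobenioid.DdashFromD p k _ (GaloisValDatum.normVal k) (D.goodLocalFrobenioidOfEmb p k ι hX) := by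
  refine D.ddashFromD_goodLocalFrobenioidOfEmb_of_forall_map_ker p k ι hX hd fun φ => ?_
  have h := hgeom (e.trans (φ.trans e.symm))
  unfold FundamentalExtension.PreservesGeom at h
  apply_fun Subgroup.map e.toMulEquiv.toMonoidHom at h
  rw [Subgroup.map_map] at h
  rw [← he, Subgroup.map_map]
  convert h using 2
  refine MonoidHom.ext fun x => ?_
  change φ (e x) = e ((e.trans (φ.trans e.symm)) x)
  simp

/-- **[IUTchI] Ex. 3.3 (iii) (a) for `D` at `v̲`, `K_v̲ = k`, chosen embedding** (`goodLocalFrobenioid`), conditional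
on [AbsAnab] Lem. 1.3.8 in the form `hΔ`. ([IUTchI] Ex 3.3 (iii) (a) p.79) [claim: Mochizuki2012, status: disputed] -/
theorem ddashFromD_goodLocalFrobenioid_of_forall_map_ker [SecondCountableTopology D.PiC]
    (hX : IsOpen (D.PiXarrow : Set D.PiC)) (hd : DenseRange (algebraMap K k))
    (hΔ : ∀ φ : D.PiLoc D.PiXarrow (localToGF F k (localEmb (K := K) (Fbar := Fbar) (AlgebraicClosure k))) ≃ₜ*
        D.PiLoc D.PiXarrow (localToGF F k (localEmb (K := K) (Fbar := Fbar) (AlgebraicClosure k))),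
      (D.augLoc D.PiXarrow (localToGF F k (localEmb (K := K) (Fbar := Fbar) (AlgebraicClosure k)))).ker.map φ.toMulEquiv.toMonoidHom =
        (D.augLoc D.PiXarrow (localToGF F k (localEmb (K := K) (Fbar := Fbar) (AlgebraicClosure k)))).ker) :
    @GoodLocalFrobenioid.DdashFromD p k _ (GaloisValDatum.normVal k) (D.goodLocalFrobenioid p k hX) :=
  D.ddashFromD_goodLocalFrobenioidOfEmb_of_forall_map_ker p k _ hX hd hΔ

end InitialThetaData

end Datum

/-! ### At an actual place `v̲ = w ∣ p` of `K` -/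

noncomputable section Place

open Literature.NumberTheory.NumberFields IsDedekindDomain NumberField

variable {F : Type u} {K : Type} {Fbar : Type} [Field F] [NumberField F] [Field K] [NumberField K]
  [Algebra F K] [Field Fbar] [Algebra F Fbar] [Algebra K Fbar] [IsScalarTower F K Fbar] [Normal K Fbar]
  {E : WeierstrassCurve F} [E.IsElliptic] {l : ℕ} {Pb : BadPlacePredicates K}
  (D : InitialThetaData F K Fbar E l Pb) (w : HeightOneSpectrum (𝓞 K)) (p : ℕ) [Fact p.Prime]
  (hw : ((p : ℕ) : 𝓞 K) ∈ w.asIdeal)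

namespace InitialThetaData

/-- **[IUTchI] Ex. 3.3 (iii) (a) for `D` at the finite place `v̲ = w ∣ p` of `K`** (`K_v̲ := K_w`, `Ω := K̄_w`,
`Π_v̲ := Π_{X̲→_K} ×_{G_K} Gal(K̄_w/K_w)`; `K ⊆ K_w` is dense, so `G_w` is Galois-countable by a theorem), conditional
on [AbsAnab] Lem. 1.3.8 in the form `hΔ` and the Galois-countability of `Π_{C_F}`.
([IUTchI] Ex 3.3 (iii) (a) p.79) [claim: Mochizuki2012, status: disputed] -/
theorem ddashFromD_goodLocalFrobenioidAt_of_forall_map_ker [SecondCountableTopology D.PiC]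
    (hX : IsOpen (D.PiXarrow : Set D.PiC))
    (hΔ : letI : Algebra K (RescaledCompletion K p w hw) := inferInstanceAs (Algebra K (w.adicCompletion K))
      ∀ φ : D.PiLoc D.PiXarrow (localToGF F (RescaledCompletion K p w hw)
          (localEmb (K := K) (Fbar := Fbar) (AlgebraicClosure (RescaledCompletion K p w hw)))) ≃ₜ*
        D.PiLoc D.PiXarrow (localToGF F (RescaledCompletion K p w hw)
          (localEmb (K := K) (Fbar := Fbar) (AlgebraicClosure (RescaledCompletion K p w hw)))),
      (D.augLoc D.PiXarrow (localToGF F (RescaledCompletion K p w hw)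
          (localEmb (K := K) (Fbar := Fbar) (AlgebraicClosure (RescaledCompletion K p w hw))))).ker.map φ.toMulEquiv.toMonoidHom =
        (D.augLoc D.PiXarrow (localToGF F (RescaledCompletion K p w hw)
          (localEmb (K := K) (Fbar := Fbar) (AlgebraicClosure (RescaledCompletion K p w hw))))).ker) :
    @GoodLocalFrobenioid.DdashFromD p (RescaledCompletion K p w hw) _
      (GaloisValDatum.normVal (RescaledCompletion K p w hw)) (D.goodLocalFrobenioidAt w p hw hX) := by
  letI : Algebra K (RescaledCompletion K p w hw) := inferInstanceAs (Algebra K (w.adicCompletion K))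
  haveI := GaloisValDatum.finiteDimensional_rescaledCompletion K p w hw
  exact D.ddashFromD_goodLocalFrobenioid_of_forall_map_ker p (RescaledCompletion K p w hw) hX
    (HeightOneSpectrum.denseRange_algebraMap K w) hΔ

end InitialThetaData

end Place

/-! ### v2 (append): the Galois-countability binder from FACT F-0240 `GeomTFG` ([AbsTopI] Prop. 2.2) by name -/

noncomputable section GeomTFG

variable {F : Type u} {K : Type} {Fbar : Type} [Field F] [NumberField F] [Field K] [NumberField K]
  [Algebra F K] [Field Fbar] [Algebra F Fbar] [Algebra K Fbar] [IsScalarTower F K Fbar] [Normal K Fbar]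
  {E : WeierstrassCurve F} [E.IsElliptic] {l : ℕ} {Pb : BadPlacePredicates K}
  (D : InitialThetaData F K Fbar E l Pb)

namespace InitialThetaData

omit [IsScalarTower F K Fbar] [Normal K Fbar] in
/-- **`Π_{C_F}` is Galois-countable as soon as `Δ_{C_F}` is topologically finitely generated** — FACT F-0240
`FundamentalExtension.GeomTFG` ([AbsTopI] Prop. 2.2) BY NAME, through abc-iut-L5-t6's PROVED (E2)
`Rmk253.tameGaloisCountable_of_geomTFG` and (E1) for the countable field `F`. [claim: Mochizuki2012, status: disputed] -/
theorem secondCountableTopology_PiC_of_geomTFG (h : D.geom.extF.GeomTFG) : SecondCountableTopology D.PiC :=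
  D.secondCountableTopology_PiC_of_tameGaloisCountable (Rmk253.tameGaloisCountable_of_geomTFG _ h)

variable (w : IsDedekindDomain.HeightOneSpectrum (NumberField.RingOfIntegers K)) (p : ℕ) [Fact p.Prime]
  (hw : ((p : ℕ) : NumberField.RingOfIntegers K) ∈ w.asIdeal)

open Literature.NumberTheory.NumberFields in
/-- **[IUTchI] Ex. 3.3 (iii) (a) for `D` at the finite place `v̲ = w ∣ p` of `K`, MODULO EXACTLY TWO FROZEN FACTS BY
NAME / IN PRINTED SHAPE**: F-0240 `GeomTFG` for `Π_{C_F} ↠ G_F` ([AbsTopI] Prop. 2.2: `Δ_{C_F}` topologically finitely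
generated — gives Galois-countability of `Π_{C_F}`, [IUTchI] Rmk. 2.5.3 (ii)) and [AbsAnab] Lem. 1.3.8 for
`Π_v̲ = Π_{X̲→_v̲}` (F-0007 `PreservesGeom`, here in the unfolded shape `hΔ`); plus the datum's openness input `hX`
(Def. 3.1 (f)).  `K_v̲ := K_w` (abc-iut-S7's `RescaledCompletion`), `Ω := K̄_w`.
([IUTchI] Ex 3.3 (iii) (a) p.79) [claim: Mochizuki2012, status: disputed] -/
theorem ddashFromD_goodLocalFrobenioidAt_of_geomTFG (hTFG : D.geom.extF.GeomTFG)
    (hX : IsOpen (D.PiXarrow : Set D.PiC))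
    (hΔ : letI : Algebra K (RescaledCompletion K p w hw) := inferInstanceAs (Algebra K (w.adicCompletion K))
      ∀ φ : D.PiLoc D.PiXarrow (localToGF F (RescaledCompletion K p w hw)
          (localEmb (K := K) (Fbar := Fbar) (AlgebraicClosure (RescaledCompletion K p w hw)))) ≃ₜ*
        D.PiLoc D.PiXarrow (localToGF F (RescaledCompletion K p w hw)
          (localEmb (K := K) (Fbar := Fbar) (AlgebraicClosure (RescaledCompletion K p w hw)))),
      (D.augLoc D.PiXarrow (localToGF F (RescaledCompletion K p w hw)
          (localEmb (K := K) (Fbar := Fbar) (AlgebraicClosure (RescaledCompletion K p w hw))))).ker.map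
          φ.toMulEquiv.toMonoidHom =
        (D.augLoc D.PiXarrow (localToGF F (RescaledCompletion K p w hw)
          (localEmb (K := K) (Fbar := Fbar) (AlgebraicClosure (RescaledCompletion K p w hw))))).ker) :
    @GoodLocalFrobenioid.DdashFromD p (RescaledCompletion K p w hw) _
      (GaloisValDatum.normVal (RescaledCompletion K p w hw)) (D.goodLocalFrobenioidAt w p hw hX) :=
  haveI := D.secondCountableTopology_PiC_of_geomTFG hTFG
  D.ddashFromD_goodLocalFrobenioidAt_of_forall_map_ker w p hw hX hΔ

end InitialThetaData

end GeomTFG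

/-! ### v3 (append): (a) UNCONDITIONALLY at the degenerate real Galois witnesses `Π_v := G_v` (no covering) -/

namespace GoodLocalFrobenioid

section Degenerate

variable {p : ℕ} [Fact p.Prime] (d : GaloisValDatum.{u} p)
  (Kv : Type) [Field Kv] [ValuativeRel Kv] (hp : ((p : Kv)) ∈ PadicFrd.intNonzero Kv)

/-- Over a REAL Galois base with `Π_v := G_v` (`aug = id`, `Δ_v = 1`), `D⊢_v ⊆ D_v` is (essentially) ALL of `D_v`:
the pull-back along the identity hits every object on the nose. [claim: Mochizuki2012, status: disputed] -/
theorem pull_id_essSurj :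
    (CosetCat.pull (MonoidHom.id d.Gal) continuous_id Function.surjective_id).EssSurj where
  mem_essImage X := ⟨X, ⟨eqToIso (by
    apply CosetCat.ext
    apply OpenSubgroup.toSubgroup_injective
    rfl)⟩⟩

/-- **(a) holds UNCONDITIONALLY over every REAL Galois base with `Π_v := G_v`** (`ofGalois d id …`): no anabelian
input is needed when there is no covering (`D⊢_v = D_v`). Non-vacuity of the typed clause at a genuine absolute
Galois group. ([IUTchI] Ex 3.3 (iii) (a) p.79) [claim: Mochizuki2012, status: disputed] -/
theorem ddashFromD_ofGalois_id :
    (ofGalois d (MonoidHom.id d.Gal) continuous_id Function.surjective_id IsOpenMap.id Kv hp).DdashFromD := by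
  haveI : (ofGalois d (MonoidHom.id d.Gal) continuous_id Function.surjective_id IsOpenMap.id Kv hp).incl.EssSurj :=
    pull_id_essSurj d
  exact reconstructibleAlong_of_essSurj _

/-- **(a) at `K_v = ℚ_p`, `Π_v := Gal(ℚ̄_p/ℚ_p)`** (`ofPadicGalois`), unconditionally — with abc-iut-w5-d096's
`basesFromC_and_dFromF_ofPadic_self`, clauses (a)(b)(c) of Ex. 3.3 (iii) all hold at this real witness with no
hypothesis. ([IUTchI] Ex 3.3 (iii) (a) p.79) [claim: Mochizuki2012, status: disputed] -/
theorem ddashFromD_ofPadicGalois (p : ℕ) [Fact p.Prime] : (ofPadicGalois p).DdashFromD :=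
  ddashFromD_ofGalois_id (GaloisValDatum.ofPadic p) ℚ_[p] (PadicFrd.p_mem_intNonzero p)

/-- **(a) at an ACTUAL place `K_v := F_v`, `Π_v := Gal(F̄_v/F_v)`** (`ofPlaceGalois`), unconditionally.
([IUTchI] Ex 3.3 (iii) (a) p.79) [claim: Mochizuki2012, status: disputed] -/
theorem ddashFromD_ofPlaceGalois (F : Type) [Field F] [NumberField F] (p : ℕ) [Fact p.Prime]
    (v : IsDedekindDomain.HeightOneSpectrum (NumberField.RingOfIntegers F))
    (hv : ((p : ℕ) : NumberField.RingOfIntegers F) ∈ v.asIdeal) :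
    @GoodLocalFrobenioid.DdashFromD p (Literature.NumberTheory.NumberFields.RescaledCompletion F p v hv) _
      (GaloisValDatum.normVal (Literature.NumberTheory.NumberFields.RescaledCompletion F p v hv))
      (ofPlaceGalois F p v hv) :=
  @ddashFromD_ofGalois_id p _ (GaloisValDatum.ofPlace F p v hv)
    (Literature.NumberTheory.NumberFields.RescaledCompletion F p v hv) _ (GaloisValDatum.normVal _)
    (GaloisValDatum.p_mem_normVal p _)

end Degenerate

end GoodLocalFrobenioid

end Literature.IUT.HodgeTheaters
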